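import Summits.QuantumFields.YangMills.Theorems.FluctuationComparisonRegPrIntLBackgroundFormCellGasKnit
import Summits.QuantumFields.YangMills.Theorems.FluctuationComparisonRegPrIntLBackgroundFormCellAnalyticKnit
import HarnessLib

/-!
# LINE g24-4 «background form» v2 — THE GAS CONE END TO END: ⟨GASᵇᵍ∘ v2⟩ → ⟨BGFORM∘ v2⟩ → S2β `FluctuationPartSmall` and GRAD∘ (texts inline, def-free)

Cell `ym3-torus` (YM ladder rung R3 = continuum `SU(2)` Yang–Mills on the three-torus — a RUNG, NOT d = 4, NOT infinite volume, NOT a mass gap, NOT Clay).  Width seat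
`ym-ust-20520-w3` (gen 21, LEAD-20520 by lineage); `--supports stmt-QuantumFields-20520 --as helper`, count-neutral, definition-free, default heartbeats.

WHAT.  The three v2 knits of the lane compose BY NAME: ✓`…BackgroundFormCellGasKnit.backgroundFormCellAnalytic_of_gas` (this seat: ⟨GASᵇᵍ∘ v2⟩ → ⟨BGFORMᵃ∘ v2⟩),
✓`…BackgroundFormCellAnalyticKnit.backgroundFormCell_of_analytic` (w5-20520 g20: ⟨BGFORMᵃ∘ v2⟩ → ⟨BGFORM∘ v2⟩) and ✓`…BackgroundFormCellKnit.fluctuationPartSmall_of_backgroundFormCell` ∕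
`oneBondOscillation_of_backgroundFormCell` (w4-20520 g20: ⟨BGFORM∘ v2⟩ → S2β ∕ GRAD∘).  This file records the compositions as theorems with the TARGET TEXTS INLINE:
★ `backgroundFormCell_of_gas : ⟨GASᵇᵍ∘ v2⟩ → ⟨BGFORM∘ v2 = TREE `Lines/background_form.lean` §1 `FluctuationBackgroundFormCan` VERBATIM⟩`,
★★ `fluctuationPartSmall_of_backgroundFormCellGas : ⟨GASᵇᵍ∘ v2⟩ → ⟨S2β `FluctuationPartSmall`, registry `Lines/semiclassical_s2beta.lean` v11.4 :412 VERBATIM⟩`,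
★★ `oneBondOscillation_of_backgroundFormCellGas : ⟨GASᵇᵍ∘ v2⟩ → ⟨GRAD∘ `OneBondOscillationCan` VERBATIM⟩` — two-∕three-token proof terms; the value is the kernel-checked TEXT FIT
(the cone's bottom letter and its top targets in one statement each).  GASᵇᵍ∘ v2's text = ✓`…CellGasKnit`'s binder (LEAD letter, HOME `g21/TEXT-GASbg-v2.w3g21.lean`).

HONEST: plumbing between HYPOTHESIS rows; GASᵇᵍ∘ v2 (analytic cube-polymer terms + a Kotecký–Preiss gas in the background registers + the response rows + geometry) is a docking row
and NOT proved; nothing of Bałaban's is asserted; BGFORM∘ v2 ∕ S2β ∕ GRAD∘ ∕ the five registered ∘-stubs (v11.4 0∕5, №36 intact) ∕ `FluctuationComparisonRegPrIntL` (20520) ∕ `YM3TorusSU2`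
NOT proved; no summit is proved by a helper.  Sorry-free, axioms standard.
[cite: Balaban1987RG1, (0.22)-(0.25) pp.256-257 and (1.11)-(1.14) p.262; Balaban1988RG2Cluster, (2.11)-(2.13) p.14 and (1.26) p.8; Balaban1989LargeFieldII, (1.98)-(1.100) p.390; Balaban1985Variational, Prop. 9 p.309; Balaban1985UV3, Thm 2 p.263 and (41) p.266]
-/

set_option autoImplicit false

noncomputable section

namespace Summit.QuantumFields.YangMills.Theorems.FluctuationComparisonRegPrIntLBackgroundFormCellGasCone

open MeasureTheory Filter Topology Set
open scoped BigOperators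
open Literature.MathematicalPhysics.QuantumFieldTheory.Balaban1983to89
open Literature.MathematicalPhysics.QuantumFieldTheory.Balaban1983to89.T3ContinuumYM3Torus T3NestedUnitLaws T3UnitLawDensityEML T3UnitScaleTilt T3TiltDescent
  T3PrintedRegularMinimiser T3LevelShift Missing T4Continuum
open Literature.MathematicalPhysics.QuantumFieldTheory.Balaban1983to89.TreeLengthTorus (TPt TDom IsTDom tsys TFaceConnected torusTreeLen torusTreeLen_nonneg sum_exp_torusTreeLen_le sum_exp_torusTreeLen_two_sites_le)
open Literature.MathematicalPhysics.QuantumFieldTheory.Balaban1983to89.TreeLengthTorusGeometry (TTouch tgeometry ttouch_refl ttouch_symm tgeometry_consts)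
open Literature.MathematicalPhysics.QuantumFieldTheory.Balaban1983to89.B12TreeDecay (kappa₀ K₀ kappa₀_nonneg K₀_pos)
open Literature.MathematicalPhysics.QuantumFieldTheory.Balaban1983to89.B12Decay510Torus (pl1 tcubeOf)
open Literature.MathematicalPhysics.QuantumFieldTheory.Balaban1983to89.B13Resummation (locE locE_congr)
open Literature.Probability.LatticeModels
open Summit.QuantumFields.YangMills.Theorems.FluctuationComparisonRegPrIntLPolymerMayerGas
open Summit.QuantumFields.YangMills.Theorems.FluctuationComparisonRegPrIntLPolymerMayerGasParam
open Summit.QuantumFields.YangMills.Theorems.FluctuationComparisonRegPrIntLBackgroundFormCellGasKnit (backgroundFormCellAnalytic_of_gas)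
open Summit.QuantumFields.YangMills.Theorems.FluctuationComparisonRegPrIntLBackgroundFormCellAnalyticKnit (backgroundFormCell_of_analytic fluctuationPartSmall_of_backgroundFormCellAnalytic oneBondOscillation_of_backgroundFormCellAnalytic)

open Classical in
/-- ★ **⟨GASᵇᵍ∘ v2⟩ → ⟨BGFORM∘ v2⟩** (TREE `Lines/background_form.lean` 22880983 §1 `FluctuationBackgroundFormCan` body VERBATIM, ws-sha16 e34325257caa6e83): the LEAD's gas knit followed by w5-20520 g20's analytic-edition knit. [cite: Balaban1987RG1, (0.22)-(0.25) pp.256-257; Balaban1985Variational, Prop. 9 p.309] -/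
theorem backgroundFormCell_of_gas
    (hG :
      ∀ (L : ℕ), ∃ pS : ℝ, ∀ (b₀ p₀ : ℝ), 0 < b₀ → pS ≤ p₀ → 0 < p₀ → ∃ ε₁ : ℝ, 0 < ε₁ ∧ ∀ (ε₀ : ℝ), 0 < ε₀ → ε₀ ≤ ε₁ →
        ∃ γ₁ : ℝ, 0 < γ₁ ∧ ∃ (κ μ C As Ag R r₁ Rₐ : ℝ) (Mc : ℕ) (_ : NeZero Mc), 0 < κ ∧ 0 ≤ μ ∧ 0 ≤ As ∧ 0 ≤ Ag ∧ 0 < Rₐ ∧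
          2 * kappa₀ (4 * 2 ^ 3) (2 * 3) ≤ r₁ ∧ r₁ + 2 * kappa₀ (4 * 2 ^ 3) (2 * 3) + 2 ≤ R ∧
          Ag * Real.exp (5 * r₁ + 1) * K₀ (4 * 2 ^ 3) (2 * 3) * 7 * 32 ≤ 1 ∧ ∀ (F : T3Family) (γ : ℝ), F.L = L → 0 < γ → γ ≤ γ₁ →
          ∃ (σ σ₂ : ℕ → ℝ), (∀ J, 0 ≤ σ J) ∧ (∀ J, 0 ≤ σ₂ J) ∧
            (∀ a : ℕ, Tendsto (fun J : ℕ => ((J : ℝ) + 1) ^ a * σ J) atTop (𝓝 0)) ∧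
            (∀ a : ℕ, Tendsto (fun J : ℕ => ((J : ℝ) + 1) ^ a * σ₂ J) atTop (𝓝 0)) ∧
            ∀ (ν : ℕ → (j : ℕ) → Measure (GaugeField (F.P j) 0 (Matrix.specialUnitaryGroup (Fin 2) ℂ))),
              (∀ K, ν K K = T4GenFunBounds.gibbsMeasure (F.P K) ((F.scheme ℰp γ).β K)) →
              (∀ K j, j < K → ν K j = Measure.map (descend F ℰp j) (ν K (j + 1))) →
              ∀ (J K : ℕ) (hJK : J ≤ K) (ρ : GaugeField (F.P J) 0 (Matrix.specialUnitaryGroup (Fin 2) ℂ) → ℝ),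
                (∀ U, PlaqSmall (θBal F.L γ b₀ p₀ J) U → 0 < ρ U) →
                ν K J = (fieldMeasure _ _ _).withDensity (fun U => ENNReal.ofReal (ρ U)) →
                ContinuousOn ρ {U | PlaqSmall (θBal F.L γ b₀ p₀ J) U} →
                ∃ (c₀ : ℝ) (d : PBond (F.P J) 0 → PBond (F.P J) 0 → ℝ) (blk : PBond (F.P K) 0 → PBond (F.P J) 0)
                  (M : GaugeField (F.P J) 0 (Matrix.specialUnitaryGroup (Fin 2) ℂ) → PBond (F.P K) 0 → (Fin 8 → ℝ))
                  (Ncb : ℕ) (_ : NeZero Ncb) (ecb : PBond (F.P J) 0 → TPt 3 (Ncb * Mc))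
                  (D : PBond (F.P K) 0 → Set (Fin 8 → ℂ))
                  (𝒮 : Finset (TPt 3 Ncb) → (PBond (F.P K) 0 → (Fin 8 → ℂ)) → ℂ)
                  (act : TDom 3 Ncb → (PBond (F.P K) 0 → (Fin 8 → ℂ)) → ℂ),
                  (∀ x y, 0 ≤ d x y) ∧ (∀ x y, d x y = d y x) ∧ (∀ x y z, d x z ≤ d x y + d y z) ∧
                  (∀ x, ∑ y, Real.exp (-(μ * d x y)) ≤ C) ∧
                  (∀ b b' : PBond (F.P J) 0, κ * (b.src.tdist b'.src : ℝ) ≤ μ * d b b') ∧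
                  (∀ c c' : PBond (F.P J) 0, 2 * μ * d c c' ≤ (r₁ / 2 / ((Mc : ℝ) * 3)) * pl1 (ecb c - ecb c')) ∧
                  (∀ e, IsOpen (D e)) ∧
                  (∀ (U : GaugeField (F.P J) 0 (Matrix.specialUnitaryGroup (Fin 2) ℂ)), PlaqSmall (θBal F.L γ b₀ p₀ J) U →
                      ∀ e, Metric.ball (fun (i : Fin 8) => (M U e i : ℂ)) (2 * Rₐ) ⊆ D e) ∧
                  (∀ (Y : Finset (TPt 3 Ncb)) (q q' : PBond (F.P K) 0 → (Fin 8 → ℂ)),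
                      (∀ e, tcubeOf Ncb Mc (ecb (blk e)) ∈ Y → q e = q' e) → 𝒮 Y q = 𝒮 Y q') ∧
                  (∀ Y : Finset (TPt 3 Ncb), ¬ TFaceConnected Y → ∀ q, 𝒮 Y q = 0) ∧
                  (∀ Y, DifferentiableOn ℂ (𝒮 Y) {q | ∀ e, q e ∈ D e}) ∧
                  (∀ Y, ∀ q ∈ {q : PBond (F.P K) 0 → (Fin 8 → ℂ) | ∀ e, q e ∈ D e}, ‖𝒮 Y q‖ ≤ As * Real.exp (-r₁ * torusTreeLen Y)) ∧
                  (∀ (Z : TDom 3 Ncb) (q q' : PBond (F.P K) 0 → (Fin 8 → ℂ)),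
                      (∀ e, tcubeOf Ncb Mc (ecb (blk e)) ∈ Z.1 → q e = q' e) → act Z q = act Z q') ∧
                  (∀ Z, DifferentiableOn ℂ (act Z) {q | ∀ e, q e ∈ D e}) ∧
                  (∀ Z, ∀ q ∈ {q : PBond (F.P K) 0 → (Fin 8 → ℂ) | ∀ e, q e ∈ D e}, ‖act Z q‖ ≤ Ag * Real.exp (-(R * torusTreeLen Z.1))) ∧
                  (∀ (U : GaugeField (F.P J) 0 (Matrix.specialUnitaryGroup (Fin 2) ℂ)), PlaqSmall (θBal F.L γ b₀ p₀ J) U →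
                      ∀ Z, (act Z (fun e (i : Fin 8) => (M U e i : ℂ))).im = 0) ∧
                  (∀ (b : PBond (F.P J) 0) (U V : GaugeField (F.P J) 0 (Matrix.specialUnitaryGroup (Fin 2) ℂ)),
                      PlaqSmall (θBal F.L γ b₀ p₀ J) U → PlaqSmall (θBal F.L γ b₀ p₀ J) V → (∀ e, e ≠ b → U e = V e) →
                      ∀ e, ‖M U e - M V e‖ ≤ σ J * Real.exp (-(2 * μ * d b (blk e)))) ∧
                  (∀ (b b' : PBond (F.P J) 0) (U V W Z : GaugeField (F.P J) 0 (Matrix.specialUnitaryGroup (Fin 2) ℂ)),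
                      PlaqSmall (θBal F.L γ b₀ p₀ J) U → PlaqSmall (θBal F.L γ b₀ p₀ J) V →
                      PlaqSmall (θBal F.L γ b₀ p₀ J) W → PlaqSmall (θBal F.L γ b₀ p₀ J) Z →
                      (∀ e, e ≠ b → U e = V e) → (∀ e, e ≠ b' → U e = W e) → (∀ e, e ≠ b' → V e = Z e) → (∀ e, e ≠ b → W e = Z e) →
                      ∀ e, ‖M U e - M W e - M V e + M Z e‖ ≤
                        σ₂ J * (Real.exp (-(2 * μ * d b (blk e))) * Real.exp (-(2 * μ * d (blk e) b')))) ∧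
                  (∀ U : GaugeField (F.P J) 0 (Matrix.specialUnitaryGroup (Fin 2) ℂ), PlaqSmall (θBal F.L γ b₀ p₀ J) U →
                      Real.log (ρ U) + (F.scheme ℰp γ).β K * minActionRegPr F J K hJK ε₀ U =
                        c₀ + ∑ Y, (𝒮 Y (fun e (i : Fin 8) => (M U e i : ℂ))).re +
                          Real.log (polymerPartitionFunction TTouch (fun Z : TDom 3 Ncb => act Z (fun e (i : Fin 8) => (M U e i : ℂ))) Finset.univ).re)) :
    ∀ (L : ℕ), ∃ pS : ℝ, ∀ (b₀ p₀ : ℝ), 0 < b₀ → pS ≤ p₀ → 0 < p₀ → ∃ ε₁ : ℝ, 0 < ε₁ ∧ ∀ (ε₀ : ℝ), 0 < ε₀ → ε₀ ≤ ε₁ →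
      ∃ γ₁ : ℝ, 0 < γ₁ ∧ ∃ (κ μ C A Hc : ℝ), 0 < κ ∧ 0 ≤ μ ∧ 0 ≤ A ∧ 0 ≤ Hc ∧ ∀ (F : T3Family) (γ : ℝ), F.L = L → 0 < γ → γ ≤ γ₁ →
        ∃ (σ σ₂ : ℕ → ℝ), (∀ J, 0 ≤ σ J) ∧ (∀ J, 0 ≤ σ₂ J) ∧
          (∀ a : ℕ, Tendsto (fun J : ℕ => ((J : ℝ) + 1) ^ a * σ J) atTop (𝓝 0)) ∧
          (∀ a : ℕ, Tendsto (fun J : ℕ => ((J : ℝ) + 1) ^ a * σ₂ J) atTop (𝓝 0)) ∧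
          ∀ (ν : ℕ → (j : ℕ) → Measure (GaugeField (F.P j) 0 (Matrix.specialUnitaryGroup (Fin 2) ℂ))),
            (∀ K, ν K K = T4GenFunBounds.gibbsMeasure (F.P K) ((F.scheme ℰp γ).β K)) →
            (∀ K j, j < K → ν K j = Measure.map (descend F ℰp j) (ν K (j + 1))) →
            ∀ (J K : ℕ) (hJK : J ≤ K) (ρ : GaugeField (F.P J) 0 (Matrix.specialUnitaryGroup (Fin 2) ℂ) → ℝ),
              (∀ U, PlaqSmall (θBal F.L γ b₀ p₀ J) U → 0 < ρ U) →
              ν K J = (fieldMeasure _ _ _).withDensity (fun U => ENNReal.ofReal (ρ U)) →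
              ContinuousOn ρ {U | PlaqSmall (θBal F.L γ b₀ p₀ J) U} →
              ∃ (c₀ : ℝ) (d : PBond (F.P J) 0 → PBond (F.P J) 0 → ℝ) (blk : PBond (F.P K) 0 → PBond (F.P J) 0)
                (M : GaugeField (F.P J) 0 (Matrix.specialUnitaryGroup (Fin 2) ℂ) → PBond (F.P K) 0 → (Fin 8 → ℝ))
                (T : Finset (PBond (F.P J) 0) → (PBond (F.P K) 0 → (Fin 8 → ℝ)) → ℝ)
                (ℓ h : Finset (PBond (F.P J) 0) → ℝ),
                (∀ x y, 0 ≤ d x y) ∧ (∀ x y, d x y = d y x) ∧ (∀ x y z, d x z ≤ d x y + d y z) ∧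
                (∀ x, ∑ y, Real.exp (-(μ * d x y)) ≤ C) ∧
                (∀ b b' : PBond (F.P J) 0, κ * (b.src.tdist b'.src : ℝ) ≤ μ * d b b') ∧
                (∀ X, 0 ≤ ℓ X) ∧ (∀ X, 0 ≤ h X) ∧
                (∀ c, ∑ X ∈ Finset.univ.filter (fun X => c ∈ X), ℓ X ≤ A) ∧
                (∀ c c', ∑ X ∈ Finset.univ.filter (fun X => c ∈ X ∧ c' ∈ X), h X ≤ Hc * Real.exp (-(2 * μ * d c c'))) ∧
                (∀ (X : Finset (PBond (F.P J) 0)) (U V : GaugeField (F.P J) 0 (Matrix.specialUnitaryGroup (Fin 2) ℂ)),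
                    PlaqSmall (θBal F.L γ b₀ p₀ J) U → PlaqSmall (θBal F.L γ b₀ p₀ J) V →
                    ∀ (S₁ : PBond (F.P J) 0 → ℝ), (∀ c, 0 ≤ S₁ c) →
                    (∀ e, blk e ∈ X → ‖M U e - M V e‖ ≤ S₁ (blk e)) →
                    |T X (M U) - T X (M V)| ≤ ℓ X * ∑ c ∈ X, S₁ c) ∧
                (∀ (X : Finset (PBond (F.P J) 0)) (U V W Z : GaugeField (F.P J) 0 (Matrix.specialUnitaryGroup (Fin 2) ℂ)),
                    PlaqSmall (θBal F.L γ b₀ p₀ J) U → PlaqSmall (θBal F.L γ b₀ p₀ J) V →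
                    PlaqSmall (θBal F.L γ b₀ p₀ J) W → PlaqSmall (θBal F.L γ b₀ p₀ J) Z →
                    ∀ (S₁ S₂ S₁₂ : PBond (F.P J) 0 → ℝ), (∀ c, 0 ≤ S₁ c) → (∀ c, 0 ≤ S₂ c) → (∀ c, 0 ≤ S₁₂ c) →
                    (∀ e, blk e ∈ X → ‖M W e - M Z e‖ ≤ S₁ (blk e)) →
                    (∀ e, blk e ∈ X → ‖M V e - M Z e‖ ≤ S₂ (blk e)) →
                    (∀ e, blk e ∈ X → ‖M U e - M W e - M V e + M Z e‖ ≤ S₁₂ (blk e)) →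
                    |T X (M U) - T X (M W) - T X (M V) + T X (M Z)| ≤
                      h X * (∑ c ∈ X, S₁ c) * (∑ c ∈ X, S₂ c) + ℓ X * ∑ c ∈ X, S₁₂ c) ∧
                (∀ (b : PBond (F.P J) 0) (U V : GaugeField (F.P J) 0 (Matrix.specialUnitaryGroup (Fin 2) ℂ)),
                    PlaqSmall (θBal F.L γ b₀ p₀ J) U → PlaqSmall (θBal F.L γ b₀ p₀ J) V → (∀ e, e ≠ b → U e = V e) →
                    ∀ e, ‖M U e - M V e‖ ≤ σ J * Real.exp (-(2 * μ * d b (blk e)))) ∧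
                (∀ (b b' : PBond (F.P J) 0) (U V W Z : GaugeField (F.P J) 0 (Matrix.specialUnitaryGroup (Fin 2) ℂ)),
                    PlaqSmall (θBal F.L γ b₀ p₀ J) U → PlaqSmall (θBal F.L γ b₀ p₀ J) V →
                    PlaqSmall (θBal F.L γ b₀ p₀ J) W → PlaqSmall (θBal F.L γ b₀ p₀ J) Z →
                    (∀ e, e ≠ b → U e = V e) → (∀ e, e ≠ b' → U e = W e) → (∀ e, e ≠ b' → V e = Z e) → (∀ e, e ≠ b → W e = Z e) →
                    ∀ e, ‖M U e - M W e - M V e + M Z e‖ ≤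
                      σ₂ J * (Real.exp (-(2 * μ * d b (blk e))) * Real.exp (-(2 * μ * d (blk e) b')))) ∧
                (∀ U : GaugeField (F.P J) 0 (Matrix.specialUnitaryGroup (Fin 2) ℂ), PlaqSmall (θBal F.L γ b₀ p₀ J) U →
                    Real.log (ρ U) + (F.scheme ℰp γ).β K * minActionRegPr F J K hJK ε₀ U = c₀ + ∑ X, T X (M U)) :=
  backgroundFormCell_of_analytic (backgroundFormCellAnalytic_of_gas hG)

open Classical in
/-- ★★ **⟨GASᵇᵍ∘ v2⟩ → S2β `FluctuationPartSmall`** (registry `Lines/semiclassical_s2beta.lean` v11.4 §2 :412 VERBATIM, ws-sha16 e30624f0b884478a; = `Lines/runpair_organ.lean` S2β): three knits composed (this seat ∘ w5 g20 ∘ w4 g20). [cite: Balaban1985UV3, Thm 2 p.263 and (41) p.266; Balaban1987RG1, Thm 1 p.259] -/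
theorem fluctuationPartSmall_of_backgroundFormCellGas
    (hG :
      ∀ (L : ℕ), ∃ pS : ℝ, ∀ (b₀ p₀ : ℝ), 0 < b₀ → pS ≤ p₀ → 0 < p₀ → ∃ ε₁ : ℝ, 0 < ε₁ ∧ ∀ (ε₀ : ℝ), 0 < ε₀ → ε₀ ≤ ε₁ →
        ∃ γ₁ : ℝ, 0 < γ₁ ∧ ∃ (κ μ C As Ag R r₁ Rₐ : ℝ) (Mc : ℕ) (_ : NeZero Mc), 0 < κ ∧ 0 ≤ μ ∧ 0 ≤ As ∧ 0 ≤ Ag ∧ 0 < Rₐ ∧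
          2 * kappa₀ (4 * 2 ^ 3) (2 * 3) ≤ r₁ ∧ r₁ + 2 * kappa₀ (4 * 2 ^ 3) (2 * 3) + 2 ≤ R ∧
          Ag * Real.exp (5 * r₁ + 1) * K₀ (4 * 2 ^ 3) (2 * 3) * 7 * 32 ≤ 1 ∧ ∀ (F : T3Family) (γ : ℝ), F.L = L → 0 < γ → γ ≤ γ₁ →
          ∃ (σ σ₂ : ℕ → ℝ), (∀ J, 0 ≤ σ J) ∧ (∀ J, 0 ≤ σ₂ J) ∧
            (∀ a : ℕ, Tendsto (fun J : ℕ => ((J : ℝ) + 1) ^ a * σ J) atTop (𝓝 0)) ∧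
            (∀ a : ℕ, Tendsto (fun J : ℕ => ((J : ℝ) + 1) ^ a * σ₂ J) atTop (𝓝 0)) ∧
            ∀ (ν : ℕ → (j : ℕ) → Measure (GaugeField (F.P j) 0 (Matrix.specialUnitaryGroup (Fin 2) ℂ))),
              (∀ K, ν K K = T4GenFunBounds.gibbsMeasure (F.P K) ((F.scheme ℰp γ).β K)) →
              (∀ K j, j < K → ν K j = Measure.map (descend F ℰp j) (ν K (j + 1))) →
              ∀ (J K : ℕ) (hJK : J ≤ K) (ρ : GaugeField (F.P J) 0 (Matrix.specialUnitaryGroup (Fin 2) ℂ) → ℝ),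
                (∀ U, PlaqSmall (θBal F.L γ b₀ p₀ J) U → 0 < ρ U) →
                ν K J = (fieldMeasure _ _ _).withDensity (fun U => ENNReal.ofReal (ρ U)) →
                ContinuousOn ρ {U | PlaqSmall (θBal F.L γ b₀ p₀ J) U} →
                ∃ (c₀ : ℝ) (d : PBond (F.P J) 0 → PBond (F.P J) 0 → ℝ) (blk : PBond (F.P K) 0 → PBond (F.P J) 0)
                  (M : GaugeField (F.P J) 0 (Matrix.specialUnitaryGroup (Fin 2) ℂ) → PBond (F.P K) 0 → (Fin 8 → ℝ))
                  (Ncb : ℕ) (_ : NeZero Ncb) (ecb : PBond (F.P J) 0 → TPt 3 (Ncb * Mc))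
                  (D : PBond (F.P K) 0 → Set (Fin 8 → ℂ))
                  (𝒮 : Finset (TPt 3 Ncb) → (PBond (F.P K) 0 → (Fin 8 → ℂ)) → ℂ)
                  (act : TDom 3 Ncb → (PBond (F.P K) 0 → (Fin 8 → ℂ)) → ℂ),
                  (∀ x y, 0 ≤ d x y) ∧ (∀ x y, d x y = d y x) ∧ (∀ x y z, d x z ≤ d x y + d y z) ∧
                  (∀ x, ∑ y, Real.exp (-(μ * d x y)) ≤ C) ∧
                  (∀ b b' : PBond (F.P J) 0, κ * (b.src.tdist b'.src : ℝ) ≤ μ * d b b') ∧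
                  (∀ c c' : PBond (F.P J) 0, 2 * μ * d c c' ≤ (r₁ / 2 / ((Mc : ℝ) * 3)) * pl1 (ecb c - ecb c')) ∧
                  (∀ e, IsOpen (D e)) ∧
                  (∀ (U : GaugeField (F.P J) 0 (Matrix.specialUnitaryGroup (Fin 2) ℂ)), PlaqSmall (θBal F.L γ b₀ p₀ J) U →
                      ∀ e, Metric.ball (fun (i : Fin 8) => (M U e i : ℂ)) (2 * Rₐ) ⊆ D e) ∧
                  (∀ (Y : Finset (TPt 3 Ncb)) (q q' : PBond (F.P K) 0 → (Fin 8 → ℂ)),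
                      (∀ e, tcubeOf Ncb Mc (ecb (blk e)) ∈ Y → q e = q' e) → 𝒮 Y q = 𝒮 Y q') ∧
                  (∀ Y : Finset (TPt 3 Ncb), ¬ TFaceConnected Y → ∀ q, 𝒮 Y q = 0) ∧
                  (∀ Y, DifferentiableOn ℂ (𝒮 Y) {q | ∀ e, q e ∈ D e}) ∧
                  (∀ Y, ∀ q ∈ {q : PBond (F.P K) 0 → (Fin 8 → ℂ) | ∀ e, q e ∈ D e}, ‖𝒮 Y q‖ ≤ As * Real.exp (-r₁ * torusTreeLen Y)) ∧
                  (∀ (Z : TDom 3 Ncb) (q q' : PBond (F.P K) 0 → (Fin 8 → ℂ)),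
                      (∀ e, tcubeOf Ncb Mc (ecb (blk e)) ∈ Z.1 → q e = q' e) → act Z q = act Z q') ∧
                  (∀ Z, DifferentiableOn ℂ (act Z) {q | ∀ e, q e ∈ D e}) ∧
                  (∀ Z, ∀ q ∈ {q : PBond (F.P K) 0 → (Fin 8 → ℂ) | ∀ e, q e ∈ D e}, ‖act Z q‖ ≤ Ag * Real.exp (-(R * torusTreeLen Z.1))) ∧
                  (∀ (U : GaugeField (F.P J) 0 (Matrix.specialUnitaryGroup (Fin 2) ℂ)), PlaqSmall (θBal F.L γ b₀ p₀ J) U →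
                      ∀ Z, (act Z (fun e (i : Fin 8) => (M U e i : ℂ))).im = 0) ∧
                  (∀ (b : PBond (F.P J) 0) (U V : GaugeField (F.P J) 0 (Matrix.specialUnitaryGroup (Fin 2) ℂ)),
                      PlaqSmall (θBal F.L γ b₀ p₀ J) U → PlaqSmall (θBal F.L γ b₀ p₀ J) V → (∀ e, e ≠ b → U e = V e) →
                      ∀ e, ‖M U e - M V e‖ ≤ σ J * Real.exp (-(2 * μ * d b (blk e)))) ∧
                  (∀ (b b' : PBond (F.P J) 0) (U V W Z : GaugeField (F.P J) 0 (Matrix.specialUnitaryGroup (Fin 2) ℂ)),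
                      PlaqSmall (θBal F.L γ b₀ p₀ J) U → PlaqSmall (θBal F.L γ b₀ p₀ J) V →
                      PlaqSmall (θBal F.L γ b₀ p₀ J) W → PlaqSmall (θBal F.L γ b₀ p₀ J) Z →
                      (∀ e, e ≠ b → U e = V e) → (∀ e, e ≠ b' → U e = W e) → (∀ e, e ≠ b' → V e = Z e) → (∀ e, e ≠ b → W e = Z e) →
                      ∀ e, ‖M U e - M W e - M V e + M Z e‖ ≤
                        σ₂ J * (Real.exp (-(2 * μ * d b (blk e))) * Real.exp (-(2 * μ * d (blk e) b')))) ∧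
                  (∀ U : GaugeField (F.P J) 0 (Matrix.specialUnitaryGroup (Fin 2) ℂ), PlaqSmall (θBal F.L γ b₀ p₀ J) U →
                      Real.log (ρ U) + (F.scheme ℰp γ).β K * minActionRegPr F J K hJK ε₀ U =
                        c₀ + ∑ Y, (𝒮 Y (fun e (i : Fin 8) => (M U e i : ℂ))).re +
                          Real.log (polymerPartitionFunction TTouch (fun Z : TDom 3 Ncb => act Z (fun e (i : Fin 8) => (M U e i : ℂ))) Finset.univ).re)) :
    ∀ (L : ℕ), ∃ pS : ℝ, ∀ (b₀ p₀ : ℝ), 0 < b₀ → pS ≤ p₀ → 0 < p₀ → ∃ ε₁ : ℝ, 0 < ε₁ ∧ ∀ (ε₀ : ℝ), 0 < ε₀ → ε₀ ≤ ε₁ →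
      ∃ γ₁ : ℝ, 0 < γ₁ ∧ ∃ κ : ℝ, 0 < κ ∧ ∀ (F : T3Family) (γ : ℝ), F.L = L → 0 < γ → γ ≤ γ₁ →
        ∃ (φ : ℕ → ℝ), (∀ J, 0 ≤ φ J) ∧ Tendsto (fun J : ℕ => (J : ℝ) * φ J) atTop (𝓝 0) ∧
          ∀ (ν : ℕ → (j : ℕ) → Measure (GaugeField (F.P j) 0 (Matrix.specialUnitaryGroup (Fin 2) ℂ))),
            (∀ K, ν K K = T4GenFunBounds.gibbsMeasure (F.P K) ((F.scheme ℰp γ).β K)) →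
            (∀ K j, j < K → ν K j = Measure.map (descend F ℰp j) (ν K (j + 1))) →
            ∀ (J K : ℕ) (hJK : J ≤ K) (ρ : GaugeField (F.P J) 0 (Matrix.specialUnitaryGroup (Fin 2) ℂ) → ℝ),
              (∀ U, PlaqSmall (θBal F.L γ b₀ p₀ J) U → 0 < ρ U) →
              ν K J = (fieldMeasure _ _ _).withDensity (fun U => ENNReal.ofReal (ρ U)) →
              ContinuousOn ρ {U | PlaqSmall (θBal F.L γ b₀ p₀ J) U} →
              ∀ (b b' : PBond (F.P J) 0) (U V W Z : GaugeField (F.P J) 0 (Matrix.specialUnitaryGroup (Fin 2) ℂ)),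
                PlaqSmall (θBal F.L γ b₀ p₀ J) U → PlaqSmall (θBal F.L γ b₀ p₀ J) V →
                PlaqSmall (θBal F.L γ b₀ p₀ J) W → PlaqSmall (θBal F.L γ b₀ p₀ J) Z →
                (∀ e, e ≠ b → U e = V e) → (∀ e, e ≠ b' → U e = W e) → (∀ e, e ≠ b' → V e = Z e) → (∀ e, e ≠ b → W e = Z e) →
                |((Real.log (ρ U) + (F.scheme ℰp γ).β K * minActionRegPr F J K hJK ε₀ U)
                    - (Real.log (ρ V) + (F.scheme ℰp γ).β K * minActionRegPr F J K hJK ε₀ V))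
                  - ((Real.log (ρ W) + (F.scheme ℰp γ).β K * minActionRegPr F J K hJK ε₀ W)
                    - (Real.log (ρ Z) + (F.scheme ℰp γ).β K * minActionRegPr F J K hJK ε₀ Z))|
                  ≤ φ J * Real.exp (-(κ * (b.src.tdist b'.src : ℝ))) :=
  fluctuationPartSmall_of_backgroundFormCellAnalytic (backgroundFormCellAnalytic_of_gas hG)

open Classical in
/-- ★★ **⟨GASᵇᵍ∘ v2⟩ → GRAD∘ `OneBondOscillationCan`** (LINE g24-1 `Lines/gradient_split.lean` §0 VERBATIM, ws-sha16 21940b40ada301dd): three knits composed. [cite: Balaban1987RG1, Thm 1 (0.24)-(0.25) p.257; Balaban1989LargeFieldII, (1.98)-(1.100) p.390] -/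
theorem oneBondOscillation_of_backgroundFormCellGas
    (hG :
      ∀ (L : ℕ), ∃ pS : ℝ, ∀ (b₀ p₀ : ℝ), 0 < b₀ → pS ≤ p₀ → 0 < p₀ → ∃ ε₁ : ℝ, 0 < ε₁ ∧ ∀ (ε₀ : ℝ), 0 < ε₀ → ε₀ ≤ ε₁ →
        ∃ γ₁ : ℝ, 0 < γ₁ ∧ ∃ (κ μ C As Ag R r₁ Rₐ : ℝ) (Mc : ℕ) (_ : NeZero Mc), 0 < κ ∧ 0 ≤ μ ∧ 0 ≤ As ∧ 0 ≤ Ag ∧ 0 < Rₐ ∧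
          2 * kappa₀ (4 * 2 ^ 3) (2 * 3) ≤ r₁ ∧ r₁ + 2 * kappa₀ (4 * 2 ^ 3) (2 * 3) + 2 ≤ R ∧
          Ag * Real.exp (5 * r₁ + 1) * K₀ (4 * 2 ^ 3) (2 * 3) * 7 * 32 ≤ 1 ∧ ∀ (F : T3Family) (γ : ℝ), F.L = L → 0 < γ → γ ≤ γ₁ →
          ∃ (σ σ₂ : ℕ → ℝ), (∀ J, 0 ≤ σ J) ∧ (∀ J, 0 ≤ σ₂ J) ∧
            (∀ a : ℕ, Tendsto (fun J : ℕ => ((J : ℝ) + 1) ^ a * σ J) atTop (𝓝 0)) ∧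
            (∀ a : ℕ, Tendsto (fun J : ℕ => ((J : ℝ) + 1) ^ a * σ₂ J) atTop (𝓝 0)) ∧
            ∀ (ν : ℕ → (j : ℕ) → Measure (GaugeField (F.P j) 0 (Matrix.specialUnitaryGroup (Fin 2) ℂ))),
              (∀ K, ν K K = T4GenFunBounds.gibbsMeasure (F.P K) ((F.scheme ℰp γ).β K)) →
              (∀ K j, j < K → ν K j = Measure.map (descend F ℰp j) (ν K (j + 1))) →
              ∀ (J K : ℕ) (hJK : J ≤ K) (ρ : GaugeField (F.P J) 0 (Matrix.specialUnitaryGroup (Fin 2) ℂ) → ℝ),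
                (∀ U, PlaqSmall (θBal F.L γ b₀ p₀ J) U → 0 < ρ U) →
                ν K J = (fieldMeasure _ _ _).withDensity (fun U => ENNReal.ofReal (ρ U)) →
                ContinuousOn ρ {U | PlaqSmall (θBal F.L γ b₀ p₀ J) U} →
                ∃ (c₀ : ℝ) (d : PBond (F.P J) 0 → PBond (F.P J) 0 → ℝ) (blk : PBond (F.P K) 0 → PBond (F.P J) 0)
                  (M : GaugeField (F.P J) 0 (Matrix.specialUnitaryGroup (Fin 2) ℂ) → PBond (F.P K) 0 → (Fin 8 → ℝ))
                  (Ncb : ℕ) (_ : NeZero Ncb) (ecb : PBond (F.P J) 0 → TPt 3 (Ncb * Mc))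
                  (D : PBond (F.P K) 0 → Set (Fin 8 → ℂ))
                  (𝒮 : Finset (TPt 3 Ncb) → (PBond (F.P K) 0 → (Fin 8 → ℂ)) → ℂ)
                  (act : TDom 3 Ncb → (PBond (F.P K) 0 → (Fin 8 → ℂ)) → ℂ),
                  (∀ x y, 0 ≤ d x y) ∧ (∀ x y, d x y = d y x) ∧ (∀ x y z, d x z ≤ d x y + d y z) ∧
                  (∀ x, ∑ y, Real.exp (-(μ * d x y)) ≤ C) ∧
                  (∀ b b' : PBond (F.P J) 0, κ * (b.src.tdist b'.src : ℝ) ≤ μ * d b b') ∧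
                  (∀ c c' : PBond (F.P J) 0, 2 * μ * d c c' ≤ (r₁ / 2 / ((Mc : ℝ) * 3)) * pl1 (ecb c - ecb c')) ∧
                  (∀ e, IsOpen (D e)) ∧
                  (∀ (U : GaugeField (F.P J) 0 (Matrix.specialUnitaryGroup (Fin 2) ℂ)), PlaqSmall (θBal F.L γ b₀ p₀ J) U →
                      ∀ e, Metric.ball (fun (i : Fin 8) => (M U e i : ℂ)) (2 * Rₐ) ⊆ D e) ∧
                  (∀ (Y : Finset (TPt 3 Ncb)) (q q' : PBond (F.P K) 0 → (Fin 8 → ℂ)),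
                      (∀ e, tcubeOf Ncb Mc (ecb (blk e)) ∈ Y → q e = q' e) → 𝒮 Y q = 𝒮 Y q') ∧
                  (∀ Y : Finset (TPt 3 Ncb), ¬ TFaceConnected Y → ∀ q, 𝒮 Y q = 0) ∧
                  (∀ Y, DifferentiableOn ℂ (𝒮 Y) {q | ∀ e, q e ∈ D e}) ∧
                  (∀ Y, ∀ q ∈ {q : PBond (F.P K) 0 → (Fin 8 → ℂ) | ∀ e, q e ∈ D e}, ‖𝒮 Y q‖ ≤ As * Real.exp (-r₁ * torusTreeLen Y)) ∧
                  (∀ (Z : TDom 3 Ncb) (q q' : PBond (F.P K) 0 → (Fin 8 → ℂ)),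
                      (∀ e, tcubeOf Ncb Mc (ecb (blk e)) ∈ Z.1 → q e = q' e) → act Z q = act Z q') ∧
                  (∀ Z, DifferentiableOn ℂ (act Z) {q | ∀ e, q e ∈ D e}) ∧
                  (∀ Z, ∀ q ∈ {q : PBond (F.P K) 0 → (Fin 8 → ℂ) | ∀ e, q e ∈ D e}, ‖act Z q‖ ≤ Ag * Real.exp (-(R * torusTreeLen Z.1))) ∧
                  (∀ (U : GaugeField (F.P J) 0 (Matrix.specialUnitaryGroup (Fin 2) ℂ)), PlaqSmall (θBal F.L γ b₀ p₀ J) U →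
                      ∀ Z, (act Z (fun e (i : Fin 8) => (M U e i : ℂ))).im = 0) ∧
                  (∀ (b : PBond (F.P J) 0) (U V : GaugeField (F.P J) 0 (Matrix.specialUnitaryGroup (Fin 2) ℂ)),
                      PlaqSmall (θBal F.L γ b₀ p₀ J) U → PlaqSmall (θBal F.L γ b₀ p₀ J) V → (∀ e, e ≠ b → U e = V e) →
                      ∀ e, ‖M U e - M V e‖ ≤ σ J * Real.exp (-(2 * μ * d b (blk e)))) ∧
                  (∀ (b b' : PBond (F.P J) 0) (U V W Z : GaugeField (F.P J) 0 (Matrix.specialUnitaryGroup (Fin 2) ℂ)),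
                      PlaqSmall (θBal F.L γ b₀ p₀ J) U → PlaqSmall (θBal F.L γ b₀ p₀ J) V →
                      PlaqSmall (θBal F.L γ b₀ p₀ J) W → PlaqSmall (θBal F.L γ b₀ p₀ J) Z →
                      (∀ e, e ≠ b → U e = V e) → (∀ e, e ≠ b' → U e = W e) → (∀ e, e ≠ b' → V e = Z e) → (∀ e, e ≠ b → W e = Z e) →
                      ∀ e, ‖M U e - M W e - M V e + M Z e‖ ≤
                        σ₂ J * (Real.exp (-(2 * μ * d b (blk e))) * Real.exp (-(2 * μ * d (blk e) b')))) ∧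
                  (∀ U : GaugeField (F.P J) 0 (Matrix.specialUnitaryGroup (Fin 2) ℂ), PlaqSmall (θBal F.L γ b₀ p₀ J) U →
                      Real.log (ρ U) + (F.scheme ℰp γ).β K * minActionRegPr F J K hJK ε₀ U =
                        c₀ + ∑ Y, (𝒮 Y (fun e (i : Fin 8) => (M U e i : ℂ))).re +
                          Real.log (polymerPartitionFunction TTouch (fun Z : TDom 3 Ncb => act Z (fun e (i : Fin 8) => (M U e i : ℂ))) Finset.univ).re)) :
    ∀ (L : ℕ), ∃ pS : ℝ, ∀ (b₀ p₀ : ℝ), 0 < b₀ → pS ≤ p₀ → 0 < p₀ → ∃ ε₁ : ℝ, 0 < ε₁ ∧ ∀ (ε₀ : ℝ), 0 < ε₀ → ε₀ ≤ ε₁ →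
      ∃ γ₁ : ℝ, 0 < γ₁ ∧ ∀ (F : T3Family) (γ : ℝ), F.L = L → 0 < γ → γ ≤ γ₁ →
        ∃ (σ : ℕ → ℝ), (∀ J, 0 ≤ σ J) ∧ (∀ a : ℕ, Tendsto (fun J : ℕ => ((J : ℝ) + 1) ^ a * σ J) atTop (𝓝 0)) ∧
          ∀ (ν : ℕ → (j : ℕ) → Measure (GaugeField (F.P j) 0 (Matrix.specialUnitaryGroup (Fin 2) ℂ))),
            (∀ K, ν K K = T4GenFunBounds.gibbsMeasure (F.P K) ((F.scheme ℰp γ).β K)) →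
            (∀ K j, j < K → ν K j = Measure.map (descend F ℰp j) (ν K (j + 1))) →
            ∀ (J K : ℕ) (hJK : J ≤ K) (ρ : GaugeField (F.P J) 0 (Matrix.specialUnitaryGroup (Fin 2) ℂ) → ℝ),
              (∀ U, PlaqSmall (θBal F.L γ b₀ p₀ J) U → 0 < ρ U) →
              ν K J = (fieldMeasure _ _ _).withDensity (fun U => ENNReal.ofReal (ρ U)) →
              ContinuousOn ρ {U | PlaqSmall (θBal F.L γ b₀ p₀ J) U} →
              ∀ (b : PBond (F.P J) 0) (U V : GaugeField (F.P J) 0 (Matrix.specialUnitaryGroup (Fin 2) ℂ)),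
                PlaqSmall (θBal F.L γ b₀ p₀ J) U → PlaqSmall (θBal F.L γ b₀ p₀ J) V →
                (∀ e, e ≠ b → U e = V e) →
                |(Real.log (ρ U) + (F.scheme ℰp γ).β K * minActionRegPr F J K hJK ε₀ U)
                    - (Real.log (ρ V) + (F.scheme ℰp γ).β K * minActionRegPr F J K hJK ε₀ V)| ≤ σ J :=
  oneBondOscillation_of_backgroundFormCellAnalytic (backgroundFormCellAnalytic_of_gas hG)

end Summit.QuantumFields.YangMills.Theorems.FluctuationComparisonRegPrIntLBackgroundFormCellGasCone

end
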